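import Summits.MatrixMultiplication.OmegaCensus.STPPSmallPatternKernelSearch122R
import Summits.MatrixMultiplication.OmegaCensus.STPPSmallPatternKernelProduct

/-!
# ω-census, `(1,2,2)^4` is infeasible in `ℤ/32` — pruned kernel search, part 31

HONEST FRAMING (pub-omega census; verbatim): lottery ticket; floor = certified bounds/negative ranges.
Census STRUCTURE bookkeeping of the STPP track (seat pub-omega-stpp-3, gen 25; STRUCTURE row B5, the threshold column
`T2(H) = max {k : (1,2,2)^k ⊆ H}`, lower side), not progress on `ω`: small patterns in small groups bound no exponent.

Chunks of `STPP122Neg.search2r (zcode 32) 4` (`decide +kernel`, ≈ 278 s predicted): entries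
`(y, c'₀, xb, xb2, XB, XC, PP)` = fixed start, exclusion masks on the codes of `b₁`, `b'₁`, and the forbidden
difference masks of the start's pair-class rank (`STPPSmallPatternKernelReflect122R.lean`); assembled in `STPPSmallPatternNone122K4Z32.lean`.

References: H. Cohn, R. Kleinberg, B. Szegedy, C. Umans, FOCS 2005 (arXiv:math/0511460), Def. 5.1.
-/

set_option Elab.async false
set_option synthInstance.maxSize 8192
set_option synthInstance.maxHeartbeats 800000

namespace Summit.MatrixMultiplication.OmegaCensus

namespace STPP122Neg

open STPP211Neg

/-- Pruned kernel search (min-flag normal form), `ℤ/32`, `k = 4`, start `(y, c'₀) = (2, 6)`: whole start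
(≈ 69 s predicted). -/
theorem Z32k4r.x82 : search2r (zcode 32) 4
    [(2, 6, 0, 0, 0, 0, 89875055886649816891401734022694327144286530640480097651301881360472449643937545930180360692995842817281484729078453260635666175745491514714970671730899315438941255911800601960070567962471999712345515473227064539978324091172588335863424543702552335292277652946673993190406009970047386424526981954410735730688)] = true := by
  decide +kernel

/-- Pruned kernel search (min-flag normal form), `ℤ/32`, `k = 4`, start `(y, c'₀) = (2, 26)`: whole start
(≈ 69 s predicted). -/
theorem Z32k4r.x83 : search2r (zcode 32) 4
    [(2, 26, 0, 0, 0, 0, 89875055886649816891401734022694327144286530640480097651301881360472449643937545930180360692995842817281484729078453260635666175745491514714970671730899315438941255911800601960070567962471999712345515473227064539978324091172588335863424543702552335292277652946673993190406009970047386424526981954410735730688)] = true := by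
  decide +kernel

/-- Pruned kernel search (min-flag normal form), `ℤ/32`, `k = 4`, start `(y, c'₀) = (2, 4)`: whole start
(≈ 70 s predicted). -/
theorem Z32k4r.x84 : search2r (zcode 32) 4
    [(2, 4, 0, 0, 0, 0, 89875055887344699256470986475519609292537474363877782481251881594300021775240243600565772632902304564500062947671821840071972227223083294323609627855116608051543153328854980739029397023687386118095205450481421986462951288622284802218484678429544962402535567854898684914131758003108708215459962394019517956096)] = true := by
  decide +kernel

/-- Pruned kernel search (min-flag normal form), `ℤ/32`, `k = 4`, start `(y, c'₀) = (2, 28)`: whole start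
(≈ 70 s predicted). -/
theorem Z32k4r.x85 : search2r (zcode 32) 4
    [(2, 28, 0, 0, 0, 0, 89875055887344699256470986475519609292537474363877782481251881594300021775240243600565772632902304564500062947671821840071972227223083294323609627855116608051543153328854980739029397023687386118095205450481421986462951288622284802218484678429544962402535567854898684914131758003108708215459962394019517956096)] = true := by
  decide +kernel

end STPP122Neg

end Summit.MatrixMultiplication.OmegaCensus
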